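import Mathlib
import Summits.AnomalousDissipation.AnomalousDissipation.Theorems.SoloBlindMonodromyTaylor

/-!
# The resolvent-weighted Taylor box (solo-blind s81, engine v3.5, §24.92)

Refinement of the monodromy box certificate of `SoloBlindMonodromyTaylor`: instead of
`‖M(σ) − M₀‖ · ‖(1 − M₀)⁻¹‖ < 1` one tests the RESOLVENT-WEIGHTED deviation
`W(σ) := (1 − M₀)⁻¹ (M(σ) − M₀)`, i.e. `Σ_{1≤j≤d} |σ|^j ‖(1 − M₀)⁻¹ M_j‖ + C·τ ≤ θ < 1`, and still
concludes `‖(1 − M(σ))⁻¹‖ ≤ C/(1 − θ)` (factorisation `1 − M = (1 − M₀)(1 − W)`).  Since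
`‖(1 − M₀)⁻¹ M_j‖ ≤ C ‖M_j‖` this can only enlarge the certified box; it is what the production
engine (mboxT v3.5) evaluates in ball arithmetic.
-/

namespace Summit.AnomalousDissipation.AnomalousDissipation.Theorems

open Finset

variable {A : Type*} [NormedRing A] [NormOneClass A] [CompleteSpace A]

/-- **Weighted centre-to-box.**  If `1 − M₀` is invertible with `‖(1 − M₀)⁻¹‖ ≤ C` and
`‖(1 − M₀)⁻¹ (M − M₀)‖ ≤ θ < 1`, then `1 − M` is invertible and `‖(1 − M)⁻¹‖ ≤ C/(1 − θ)`. -/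
theorem one_sub_inverse_of_weighted_near {M₀ M : A} {C θ : ℝ} (hu : IsUnit (1 - M₀))
    (hC : ‖Ring.inverse (1 - M₀)‖ ≤ C) (hW : ‖Ring.inverse (1 - M₀) * (M - M₀)‖ ≤ θ) (hθ : θ < 1) :
    IsUnit (1 - M) ∧ ‖Ring.inverse (1 - M)‖ ≤ C / (1 - θ) := by
  obtain ⟨u, hu'⟩ := hu
  set W : A := Ring.inverse (1 - M₀) * (M - M₀) with hWdef
  have hinv : Ring.inverse (1 - M₀) = (↑u⁻¹ : A) := by rw [← hu', Ring.inverse_unit]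
  have h0 : IsUnit (1 - (0 : A)) := by simp
  have hC0 : ‖Ring.inverse (1 - (0 : A))‖ ≤ 1 := by simp
  have hWn : ‖W - 0‖ ≤ θ := by simpa using hW
  have hθ1 : θ * 1 < 1 := by simpa using hθ
  obtain ⟨hunitW, hboundW⟩ := one_sub_inverse_of_near h0 hC0 hWn hθ1
  obtain ⟨v, hv'⟩ := hunitW
  have huW : (↑u : A) * W = M - M₀ := by
    rw [hWdef, hinv, ← mul_assoc, Units.mul_inv, one_mul]
  have hfac : 1 - M = (↑u : A) * (1 - W) := by
    rw [mul_sub, mul_one, huW, hu']; abel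
  have hUV : ((u * v : Aˣ) : A) = 1 - M := by rw [Units.val_mul, hv', hfac]
  refine ⟨⟨u * v, hUV⟩, ?_⟩
  have hinvM : Ring.inverse (1 - M) = (↑v⁻¹ : A) * ↑u⁻¹ := by
    rw [← hUV, Ring.inverse_unit, mul_inv_rev, Units.val_mul]
  have hvb : ‖(↑v⁻¹ : A)‖ ≤ 1 / (1 - θ) := by
    have h := hboundW
    rw [← hv', Ring.inverse_unit, mul_one] at h
    exact h
  have hub : ‖(↑u⁻¹ : A)‖ ≤ C := hinv ▸ hC
  have hpos : 0 ≤ 1 / (1 - θ) := by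
    have : 0 < 1 - θ := by linarith
    positivity
  rw [hinvM]
  calc ‖(↑v⁻¹ : A) * ↑u⁻¹‖ ≤ ‖(↑v⁻¹ : A)‖ * ‖(↑u⁻¹ : A)‖ := norm_mul_le _ _
    _ ≤ 1 / (1 - θ) * C := mul_le_mul hvb hub (norm_nonneg _) hpos
    _ = C / (1 - θ) := by ring

variable [NormedAlgebra ℂ A]

/-- **The resolvent-weighted Taylor box.**  Centre certified (`‖(1 − M_0)⁻¹‖ ≤ C`), weighted
coefficient bounds `‖(1 − M_0)⁻¹ M_j‖ ≤ w_j (1 ≤ j ≤ d)`, remainder `‖M − Σ_{j≤d} σ^j M_j‖ ≤ τ`: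
if `Σ_{1≤j≤d} |σ|^j w_j + C τ ≤ θ < 1` then `1 − M` is invertible with `‖(1 − M)⁻¹‖ ≤ C/(1 − θ)`. -/
theorem weighted_taylor_box {M : A} (Mj : ℕ → A) (σ : ℂ) (d : ℕ) (w : ℕ → ℝ) {τ C θ : ℝ}
    (hu : IsUnit (1 - Mj 0)) (hC : ‖Ring.inverse (1 - Mj 0)‖ ≤ C)
    (hR : ‖M - ∑ j ∈ range (d + 1), σ ^ j • Mj j‖ ≤ τ)
    (hw : ∀ j, 1 ≤ j → j ≤ d → ‖Ring.inverse (1 - Mj 0) * Mj j‖ ≤ w j)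
    (hθ : (∑ j ∈ Ico 1 (d + 1), ‖σ‖ ^ j * w j) + C * τ ≤ θ) (hθ1 : θ < 1) :
    IsUnit (1 - M) ∧ ‖Ring.inverse (1 - M)‖ ≤ C / (1 - θ) := by
  refine one_sub_inverse_of_weighted_near hu hC (le_trans ?_ hθ) hθ1
  set Rz : A := Ring.inverse (1 - Mj 0) with hRz
  have hsplit : ∑ j ∈ range (d + 1), σ ^ j • Mj j = Mj 0 + ∑ j ∈ Ico 1 (d + 1), σ ^ j • Mj j := by
    rw [Finset.range_eq_Ico, Finset.sum_eq_sum_Ico_succ_bot (Nat.succ_pos d), pow_zero, one_smul]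
  have hdecomp : Rz * (M - Mj 0) = Rz * (M - ∑ j ∈ range (d + 1), σ ^ j • Mj j) +
      ∑ j ∈ Ico 1 (d + 1), σ ^ j • (Rz * Mj j) := by
    have : M - Mj 0 = (M - ∑ j ∈ range (d + 1), σ ^ j • Mj j) + ∑ j ∈ Ico 1 (d + 1), σ ^ j • Mj j := by
      rw [hsplit]; abel
    rw [this, mul_add, Finset.mul_sum]
    congr 1
    exact Finset.sum_congr rfl fun j _ => mul_smul_comm _ _ _
  have hsum : ‖∑ j ∈ Ico 1 (d + 1), σ ^ j • (Rz * Mj j)‖ ≤ ∑ j ∈ Ico 1 (d + 1), ‖σ‖ ^ j * w j := by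
    refine (norm_sum_le _ _).trans (Finset.sum_le_sum fun j hj => ?_)
    rw [Finset.mem_Ico] at hj
    rw [norm_smul, norm_pow]
    exact mul_le_mul_of_nonneg_left (hw j hj.1 (Nat.lt_succ_iff.mp hj.2)) (pow_nonneg (norm_nonneg _) _)
  have hC0 : 0 ≤ C := le_trans (norm_nonneg _) hC
  have hrem : ‖Rz * (M - ∑ j ∈ range (d + 1), σ ^ j • Mj j)‖ ≤ C * τ :=
    (norm_mul_le _ _).trans (mul_le_mul hC hR (norm_nonneg _) hC0)
  rw [hdecomp]
  calc ‖Rz * (M - ∑ j ∈ range (d + 1), σ ^ j • Mj j) + ∑ j ∈ Ico 1 (d + 1), σ ^ j • (Rz * Mj j)‖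
      ≤ ‖Rz * (M - ∑ j ∈ range (d + 1), σ ^ j • Mj j)‖ + ‖∑ j ∈ Ico 1 (d + 1), σ ^ j • (Rz * Mj j)‖ :=
        norm_add_le _ _
    _ ≤ C * τ + ∑ j ∈ Ico 1 (d + 1), ‖σ‖ ^ j * w j := add_le_add hrem hsum
    _ = (∑ j ∈ Ico 1 (d + 1), ‖σ‖ ^ j * w j) + C * τ := add_comm _ _

end Summit.AnomalousDissipation.AnomalousDissipation.Theorems
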